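import Literature.Analysis.OperatorTheory.GaussianTransferKernelSupersolution
import Mathlib.Analysis.SpecialFunctions.Gaussian.GaussianIntegral
import HarnessLib

/-!
# The harmonic step in CURVATURE coordinates, one normal mode at a time (covariant programme, brick c4(iii)-core)

Cell `ym-fleet`, crux `TwistedTraceScaling` (stmt-QuantumFields-20203), line «twolattice», stub S-BASE, lane B = COARSE-LOWER(L₁)
(design note `pub/ym-fleet/ym-20203-coarse-s1/LOWER-BLUEPRINT.md` §5–§6).  HONEST FRAMING: a one-dimensional Gaussian identity and its
finite product; fixed-lattice bookkeeping for a stub of a child of the CONDITIONAL reduction route (femto rung R2b1); not a gap, not Clay.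

In the covariant picture the transfer step at a configuration `U` reads, in the normal modes `eᵢ` of `D_U† D_U` (`D_U` the covariant
linearised curl, eigenvalues `λᵢ ≥ 0`) and with `F = F(U)` the curvature, `φᵢ = ⟨D eᵢ, F⟩`, `wᵢ` the step coordinates:
`‖F + D w‖² = ‖F‖² + Σᵢ (2φᵢwᵢ + λᵢwᵢ²)` and `⟨D eᵢ, F + D w⟩ = φᵢ + λᵢ wᵢ` (frame bookkeeping, separate file).  The model step integrand
therefore FACTORISES over the modes, each factor being the one-dimensional integral of this file:

* ★ `integral_stepMode` — for `λ > 0`, `t ≥ 0`, `b > 0`, `ĉ ≥ 0`: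
  `∫ e^{−b w²} e^{−t(2φw + λw²)} e^{−ĉ(φ + λw)²} dw = √(π/s') · e^{2tφ²/λ} · e^{−κ (φ/λ)²} · e^{−ĉ φ²}`,
  `s' = tλ + b + ĉλ²`, `κ = ((tλ)² + 2(tλ)b − (ĉλ²)²)/s'` — the substitution `y = w + φ/λ` turns it into the harmonic kernel with
  `a = tλ` against the Gaussian weight `e^{−(ĉλ²) y²}` (Literature `integral_gaussKernel_mul_gaussian_real`, Wipf §8.5.1);
* `stepGain_eq_zero_of_riccati` — at the Riccati value `(ĉλ²)² = (tλ)² + 2(tλ)b` the gain vanishes (`κ = 0`): the weight `e^{−ĉ⟨De,·⟩²}`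
  reproduces itself EXACTLY; `stepGain_nonneg_of_le` — a FATTER weight (`(ĉλ²)² ≤ (tλ)² + 2tλb`) has `κ ≥ 0` (super-solution direction,
  the valley's Gaussian gain); `integral_stepMode_riccati` — the Riccati case spelled out;
* `integral_stepMode_zero` — a zero mode (`λ = 0`, hence `φ = 0`): `∫ e^{−bw²} dw = √(π/b)` (free factor);
* `integral_stepModes_pi` — the finite product over a family of stiff modes (Fubini on `κ → ℝ`).

## References
* A. Wipf, *Statistical Approach to Quantum Field Theory*, LNP 992 (2021), §8.5.1 (8.54)–(8.58), §8.5.2 (8.64)–(8.67). [Wipf2021]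
* M. Lüscher, Nucl. Phys. B219 (1983) 233, §3 (normal modes of the small-volume gauge field). [Luscher1983]
-/

noncomputable section

open MeasureTheory Real

namespace Summit.QuantumFields.YangMills.Theorems.FemtoTransferGap.TwoLattice.Harm

open Literature.Analysis.OperatorTheory.GaussianTransferKernel

/-! ## §1 One stiff mode -/

/-- The GAIN RATE of the weight `e^{−ĉ⟨De,·⟩²}` on a mode with `D†D`-eigenvalue `λ`, potential scale `t` and kinetic constant `b`:
`κ(λ,t,b,ĉ) = ((tλ)² + 2(tλ)b − (ĉλ²)²)/(tλ + b + ĉλ²)` (the Literature gain rate at `a = tλ`, `c' = ĉλ²`). [cite: Wipf2021, §8.5.1 (8.56)–(8.57)] -/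
def stepGain (lam t b ĉ : ℝ) : ℝ :=
  ((t * lam) ^ 2 + 2 * (t * lam) * b - (ĉ * lam ^ 2) ^ 2) / (t * lam + b + ĉ * lam ^ 2)

/-- Unfolding `stepGain`. [cite: Wipf2021, §8.5.1 (8.56)–(8.57)] -/
theorem stepGain_eq (lam t b ĉ : ℝ) :
    stepGain lam t b ĉ = ((t * lam) ^ 2 + 2 * (t * lam) * b - (ĉ * lam ^ 2) ^ 2) / (t * lam + b + ĉ * lam ^ 2) := rfl

/-- The pointwise substitution `y = w + φ/λ`: the mode integrand is `e^{2tφ²/λ}` times the harmonic-kernel integrand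
`e^{−a x²} e^{−b(x−y)²} e^{−a y²} e^{−c' y²}` at `a = tλ`, `c' = ĉλ²`, `x = φ/λ`, `y = w + φ/λ`. [cite: Wipf2021, §8.5.1 (8.56)] -/
theorem stepMode_integrand_eq {lam : ℝ} (hlam : lam ≠ 0) (t b ĉ φ w : ℝ) :
    Real.exp (-(b * w ^ 2)) * Real.exp (-(t * (2 * φ * w + lam * w ^ 2))) * Real.exp (-(ĉ * (φ + lam * w) ^ 2)) =
      Real.exp (2 * (t * lam) * (φ / lam) ^ 2) *
        (Real.exp (-(t * lam * (φ / lam) ^ 2)) * Real.exp (-(b * (φ / lam - (w + φ / lam)) ^ 2)) *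
          Real.exp (-(t * lam * (w + φ / lam) ^ 2)) * Real.exp (-(ĉ * lam ^ 2 * (w + φ / lam) ^ 2))) := by
  simp only [← Real.exp_add]
  congr 1
  field_simp
  ring

/-- ★ **THE HARMONIC STEP ON ONE STIFF MODE, GENERAL WEIGHT.**  For `λ > 0`, `t ≥ 0`, `b > 0`, `ĉ ≥ 0` and every `φ`:
`∫ e^{−b w²} e^{−t(2φw + λw²)} e^{−ĉ(φ + λw)²} dw = √(π/(tλ + b + ĉλ²)) · e^{2tφ²/λ} · e^{−κ·(φ/λ)²} · e^{−ĉφ²}`, `κ = stepGain λ t b ĉ`.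
[cite: Wipf2021, §8.5.1 (8.56)–(8.57)] -/
theorem integral_stepMode {lam t b ĉ : ℝ} (hlam : 0 < lam) (ht : 0 ≤ t) (hb : 0 < b) (hĉ : 0 ≤ ĉ) (φ : ℝ) :
    ∫ w, Real.exp (-(b * w ^ 2)) * Real.exp (-(t * (2 * φ * w + lam * w ^ 2))) * Real.exp (-(ĉ * (φ + lam * w) ^ 2)) =
      Real.sqrt (π / (t * lam + b + ĉ * lam ^ 2)) * Real.exp (2 * t * φ ^ 2 / lam) *
        Real.exp (-(stepGain lam t b ĉ * (φ / lam) ^ 2)) * Real.exp (-(ĉ * φ ^ 2)) := by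
  have ha : 0 ≤ t * lam := mul_nonneg ht hlam.le
  have hc' : 0 ≤ ĉ * lam ^ 2 := mul_nonneg hĉ (sq_nonneg _)
  simp_rw [stepMode_integrand_eq hlam.ne' t b ĉ φ]
  rw [integral_const_mul]
  have hshift := integral_add_right_eq_self (μ := (volume : Measure ℝ))
    (fun y : ℝ => Real.exp (-(t * lam * (φ / lam) ^ 2)) * Real.exp (-(b * (φ / lam - y) ^ 2)) *
      Real.exp (-(t * lam * y ^ 2)) * Real.exp (-(ĉ * lam ^ 2 * y ^ 2))) (φ / lam)
  rw [hshift, integral_gaussKernel_mul_gaussian_real ha hb hc' (φ / lam), stepGain_eq]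
  have h1 : 2 * (t * lam) * (φ / lam) ^ 2 = 2 * t * φ ^ 2 / lam := by
    field_simp
  have h2 : ĉ * lam ^ 2 * (φ / lam) ^ 2 = ĉ * φ ^ 2 := by
    field_simp
  rw [h1, h2]
  ring

/-- The gain vanishes at the RICCATI value of the weight: `(ĉλ²)² = (tλ)² + 2(tλ)b ⇒ κ = 0`. [cite: Wipf2021, §8.5.1 (8.57)] -/
theorem stepGain_eq_zero_of_riccati {lam t b ĉ : ℝ} (h : (ĉ * lam ^ 2) ^ 2 = (t * lam) ^ 2 + 2 * (t * lam) * b) :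
    stepGain lam t b ĉ = 0 := by
  rw [stepGain_eq, h, sub_self, zero_div]

/-- A weight at most as sharp as the Riccati one gains: `(ĉλ²)² ≤ (tλ)² + 2(tλ)b`, `λ, t ≥ 0`, `b > 0`, `ĉ ≥ 0 ⇒ κ ≥ 0`.
[cite: Wipf2021, §8.5.1 (8.57)] -/
theorem stepGain_nonneg_of_le {lam t b ĉ : ℝ} (hlam : 0 ≤ lam) (ht : 0 ≤ t) (hb : 0 < b) (hĉ : 0 ≤ ĉ)
    (hle : (ĉ * lam ^ 2) ^ 2 ≤ (t * lam) ^ 2 + 2 * (t * lam) * b) : 0 ≤ stepGain lam t b ĉ := by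
  rw [stepGain_eq]
  have ha : 0 ≤ t * lam := mul_nonneg ht hlam
  have hc' : 0 ≤ ĉ * lam ^ 2 := mul_nonneg hĉ (sq_nonneg _)
  exact div_nonneg (by linarith) (by linarith)

/-- A weight STRICTLY fatter than the Riccati one gains strictly: `(ĉλ²)² < (tλ)² + 2(tλ)b ⇒ κ > 0`. [cite: Wipf2021, §8.5.1 (8.57)] -/
theorem stepGain_pos_of_lt {lam t b ĉ : ℝ} (hlam : 0 ≤ lam) (ht : 0 ≤ t) (hb : 0 < b) (hĉ : 0 ≤ ĉ)
    (hlt : (ĉ * lam ^ 2) ^ 2 < (t * lam) ^ 2 + 2 * (t * lam) * b) : 0 < stepGain lam t b ĉ := by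
  rw [stepGain_eq]
  have ha : 0 ≤ t * lam := mul_nonneg ht hlam
  have hc' : 0 ≤ ĉ * lam ^ 2 := mul_nonneg hĉ (sq_nonneg _)
  exact div_pos (by linarith) (by linarith)

/-- The RICCATI weight of a stiff mode: `ĉ = c/λ²` with `c = √((tλ)² + 2(tλ)b)` (so `(ĉλ²)² = (tλ)² + 2tλb`); it is non-negative.
[cite: Wipf2021, §8.5.1 (8.57)] -/
theorem riccati_weight {lam t b : ℝ} (hlam : 0 < lam) (ht : 0 ≤ t) (hb : 0 ≤ b) :
    0 ≤ Real.sqrt ((t * lam) ^ 2 + 2 * (t * lam) * b) / lam ^ 2 ∧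
      (Real.sqrt ((t * lam) ^ 2 + 2 * (t * lam) * b) / lam ^ 2 * lam ^ 2) ^ 2 = (t * lam) ^ 2 + 2 * (t * lam) * b := by
  have hl2 : 0 < lam ^ 2 := by positivity
  refine ⟨div_nonneg (Real.sqrt_nonneg _) hl2.le, ?_⟩
  rw [div_mul_cancel₀ _ hl2.ne']
  exact Real.sq_sqrt (by nlinarith [mul_nonneg ht hlam.le])

/-- ★ **THE RICCATI CASE** (exact reproduction of the ground-state weight on a stiff mode): for `λ > 0`, `t ≥ 0`, `b > 0` and `ĉ ≥ 0` with
`(ĉλ²)² = (tλ)² + 2(tλ)b`: `∫ e^{−bw²} e^{−t(2φw+λw²)} e^{−ĉ(φ+λw)²} dw = √(π/(tλ + b + ĉλ²)) · e^{2tφ²/λ} · e^{−ĉφ²}`.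
[cite: Wipf2021, §8.5.1 (8.56)–(8.57)] -/
theorem integral_stepMode_riccati {lam t b ĉ : ℝ} (hlam : 0 < lam) (ht : 0 ≤ t) (hb : 0 < b) (hĉ : 0 ≤ ĉ)
    (h : (ĉ * lam ^ 2) ^ 2 = (t * lam) ^ 2 + 2 * (t * lam) * b) (φ : ℝ) :
    ∫ w, Real.exp (-(b * w ^ 2)) * Real.exp (-(t * (2 * φ * w + lam * w ^ 2))) * Real.exp (-(ĉ * (φ + lam * w) ^ 2)) =
      Real.sqrt (π / (t * lam + b + ĉ * lam ^ 2)) * Real.exp (2 * t * φ ^ 2 / lam) * Real.exp (-(ĉ * φ ^ 2)) := by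
  rw [integral_stepMode hlam ht hb hĉ φ, stepGain_eq_zero_of_riccati h]
  simp

/-- A ZERO MODE (`λ = 0`, so `D e = 0` and `φ = ⟨De, F⟩ = 0`): the step factor is the free Gaussian `∫ e^{−bw²} dw = √(π/b)`.
[cite: Wipf2021, §8.5.1 (8.58)] -/
theorem integral_stepMode_zero {b : ℝ} (t ĉ : ℝ) :
    ∫ w : ℝ, Real.exp (-(b * w ^ 2)) * Real.exp (-(t * (2 * 0 * w + 0 * w ^ 2))) * Real.exp (-(ĉ * (0 + 0 * w) ^ 2)) =
      Real.sqrt (π / b) := by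
  have h : ∀ w : ℝ, Real.exp (-(b * w ^ 2)) * Real.exp (-(t * (2 * 0 * w + 0 * w ^ 2))) * Real.exp (-(ĉ * (0 + 0 * w) ^ 2)) =
      Real.exp (-b * w ^ 2) := fun w => by
    simp [neg_mul]
  simp_rw [h]
  exact integral_gaussian b

/-! ## §2 Finitely many stiff modes: the product (Fubini on `κ → ℝ`) -/

section Pi

variable {κ : Type*} [Fintype κ]

/-- ★ **THE HARMONIC STEP ON A FAMILY OF STIFF MODES.**  For modes `k : κ` with `λ_k > 0`, weights `ĉ_k ≥ 0`, `t ≥ 0`, `b > 0`: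
`∫_{κ → ℝ} Π_k e^{−b w_k²} e^{−t(2φ_k w_k + λ_k w_k²)} e^{−ĉ_k(φ_k + λ_k w_k)²} dw = Π_k √(π/s'_k) e^{2tφ_k²/λ_k} e^{−κ_k (φ_k/λ_k)²} e^{−ĉ_kφ_k²}`.
[cite: Wipf2021, §8.5.2 (8.64)–(8.67)] -/
theorem integral_stepModes_pi {lam ĉ : κ → ℝ} {t b : ℝ} (hlam : ∀ k, 0 < lam k) (ht : 0 ≤ t) (hb : 0 < b) (hĉ : ∀ k, 0 ≤ ĉ k)
    (φ : κ → ℝ) :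
    ∫ w : κ → ℝ, ∏ k, Real.exp (-(b * w k ^ 2)) * Real.exp (-(t * (2 * φ k * w k + lam k * w k ^ 2))) *
        Real.exp (-(ĉ k * (φ k + lam k * w k) ^ 2)) =
      ∏ k, Real.sqrt (π / (t * lam k + b + ĉ k * lam k ^ 2)) * Real.exp (2 * t * φ k ^ 2 / lam k) *
        Real.exp (-(stepGain (lam k) t b (ĉ k) * (φ k / lam k) ^ 2)) * Real.exp (-(ĉ k * φ k ^ 2)) := by
  have h := integral_fintype_prod_volume_eq_prod (𝕜 := ℝ) (E := fun _ : κ => ℝ)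
    (fun k (s : ℝ) => Real.exp (-(b * s ^ 2)) * Real.exp (-(t * (2 * φ k * s + lam k * s ^ 2))) *
      Real.exp (-(ĉ k * (φ k + lam k * s) ^ 2)))
  rw [h]
  exact Finset.prod_congr rfl fun k _ => integral_stepMode (hlam k) ht hb (hĉ k) (φ k)

/-- The product in exponential form: `Π_k √(π/s'_k) · exp(Σ_k (2tφ_k²/λ_k − κ_k(φ_k/λ_k)² − ĉ_kφ_k²))`. [cite: Wipf2021, §8.5.2 (8.64)–(8.67)] -/
theorem integral_stepModes_pi' {lam ĉ : κ → ℝ} {t b : ℝ} (hlam : ∀ k, 0 < lam k) (ht : 0 ≤ t) (hb : 0 < b) (hĉ : ∀ k, 0 ≤ ĉ k)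
    (φ : κ → ℝ) :
    ∫ w : κ → ℝ, ∏ k, Real.exp (-(b * w k ^ 2)) * Real.exp (-(t * (2 * φ k * w k + lam k * w k ^ 2))) *
        Real.exp (-(ĉ k * (φ k + lam k * w k) ^ 2)) =
      (∏ k, Real.sqrt (π / (t * lam k + b + ĉ k * lam k ^ 2))) *
        Real.exp (∑ k, (2 * t * φ k ^ 2 / lam k - stepGain (lam k) t b (ĉ k) * (φ k / lam k) ^ 2 - ĉ k * φ k ^ 2)) := by
  rw [integral_stepModes_pi hlam ht hb hĉ φ, Real.exp_sum, ← Finset.prod_mul_distrib]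
  refine Finset.prod_congr rfl fun k _ => ?_
  rw [mul_assoc, mul_assoc, ← Real.exp_add, ← Real.exp_add]
  congr 2
  ring

/-- ★ The RICCATI family (every integrated mode carries its Riccati weight): the weights reproduce themselves with the factor
`Π_k √(π/s'_k) · e^{2t Σ_k φ_k²/λ_k}` (`Σ_k φ_k²/λ_k = ‖P F‖²`, the squared projection of the curvature onto the integrated curl modes).
[cite: Wipf2021, §8.5.2 (8.64)–(8.67)] -/
theorem integral_stepModes_pi_riccati {lam ĉ : κ → ℝ} {t b : ℝ} (hlam : ∀ k, 0 < lam k) (ht : 0 ≤ t) (hb : 0 < b)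
    (hĉ : ∀ k, 0 ≤ ĉ k) (h : ∀ k, (ĉ k * lam k ^ 2) ^ 2 = (t * lam k) ^ 2 + 2 * (t * lam k) * b) (φ : κ → ℝ) :
    ∫ w : κ → ℝ, ∏ k, Real.exp (-(b * w k ^ 2)) * Real.exp (-(t * (2 * φ k * w k + lam k * w k ^ 2))) *
        Real.exp (-(ĉ k * (φ k + lam k * w k) ^ 2)) =
      (∏ k, Real.sqrt (π / (t * lam k + b + ĉ k * lam k ^ 2))) *
        Real.exp (2 * t * ∑ k, φ k ^ 2 / lam k) * Real.exp (-(∑ k, ĉ k * φ k ^ 2)) := by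
  rw [integral_stepModes_pi' hlam ht hb hĉ φ, mul_assoc, ← Real.exp_add]
  congr 2
  rw [Finset.mul_sum, ← Finset.sum_neg_distrib, ← Finset.sum_add_distrib]
  refine Finset.sum_congr rfl fun k _ => ?_
  rw [stepGain_eq_zero_of_riccati (h k)]
  ring

end Pi

/-! ## §3 Stiff and zero modes together: eigenvalues `λ ≥ 0` (appended 2026-08-27, g1) -/

/-- ★ **ONE MODE, `λ ≥ 0`.**  The general-weight step formula holds for every mode with `λ ≥ 0` provided the curvature coordinate vanishes on zero
modes (`λ = 0 ⇒ φ = 0`, which is automatic for `φ = ⟨De, F⟩` since `λ = ‖De‖²`); Lean's `·/0 = 0` makes the right-hand side `√(π/b)` there.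
[cite: Wipf2021, §8.5.1 (8.56)–(8.58)] -/
theorem integral_stepMode_of_nonneg {lam t b ĉ : ℝ} (hlam : 0 ≤ lam) (ht : 0 ≤ t) (hb : 0 < b) (hĉ : 0 ≤ ĉ) {φ : ℝ}
    (hφ : lam = 0 → φ = 0) :
    ∫ w, Real.exp (-(b * w ^ 2)) * Real.exp (-(t * (2 * φ * w + lam * w ^ 2))) * Real.exp (-(ĉ * (φ + lam * w) ^ 2)) =
      Real.sqrt (π / (t * lam + b + ĉ * lam ^ 2)) * Real.exp (2 * t * φ ^ 2 / lam) *
        Real.exp (-(stepGain lam t b ĉ * (φ / lam) ^ 2)) * Real.exp (-(ĉ * φ ^ 2)) := by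
  rcases hlam.eq_or_lt with h0 | hpos
  · have hφ0 : φ = 0 := hφ h0.symm
    subst hφ0
    rw [← h0, integral_stepMode_zero]
    simp [stepGain]
  · exact integral_stepMode hpos ht hb hĉ φ

section PiNonneg

variable {κ : Type*} [Fintype κ]

/-- ★ **A FAMILY OF MODES WITH `λ_k ≥ 0`** (stiff and zero modes together; `λ_k = 0 ⇒ φ_k = 0`): the product formula of
`integral_stepModes_pi` with zero modes contributing their free factor `√(π/b)`. [cite: Wipf2021, §8.5.2 (8.64)–(8.67)] -/
theorem integral_stepModes_pi_of_nonneg {lam ĉ : κ → ℝ} {t b : ℝ} (hlam : ∀ k, 0 ≤ lam k) (ht : 0 ≤ t) (hb : 0 < b)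
    (hĉ : ∀ k, 0 ≤ ĉ k) {φ : κ → ℝ} (hφ : ∀ k, lam k = 0 → φ k = 0) :
    ∫ w : κ → ℝ, ∏ k, Real.exp (-(b * w k ^ 2)) * Real.exp (-(t * (2 * φ k * w k + lam k * w k ^ 2))) *
        Real.exp (-(ĉ k * (φ k + lam k * w k) ^ 2)) =
      ∏ k, Real.sqrt (π / (t * lam k + b + ĉ k * lam k ^ 2)) * Real.exp (2 * t * φ k ^ 2 / lam k) *
        Real.exp (-(stepGain (lam k) t b (ĉ k) * (φ k / lam k) ^ 2)) * Real.exp (-(ĉ k * φ k ^ 2)) := by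
  have h := integral_fintype_prod_volume_eq_prod (𝕜 := ℝ) (E := fun _ : κ => ℝ)
    (fun k (s : ℝ) => Real.exp (-(b * s ^ 2)) * Real.exp (-(t * (2 * φ k * s + lam k * s ^ 2))) *
      Real.exp (-(ĉ k * (φ k + lam k * s) ^ 2)))
  rw [h]
  exact Finset.prod_congr rfl fun k _ => integral_stepMode_of_nonneg (hlam k) ht hb (hĉ k) (hφ k)

/-- The same in exponential form. [cite: Wipf2021, §8.5.2 (8.64)–(8.67)] -/
theorem integral_stepModes_pi_of_nonneg' {lam ĉ : κ → ℝ} {t b : ℝ} (hlam : ∀ k, 0 ≤ lam k) (ht : 0 ≤ t) (hb : 0 < b)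
    (hĉ : ∀ k, 0 ≤ ĉ k) {φ : κ → ℝ} (hφ : ∀ k, lam k = 0 → φ k = 0) :
    ∫ w : κ → ℝ, ∏ k, Real.exp (-(b * w k ^ 2)) * Real.exp (-(t * (2 * φ k * w k + lam k * w k ^ 2))) *
        Real.exp (-(ĉ k * (φ k + lam k * w k) ^ 2)) =
      (∏ k, Real.sqrt (π / (t * lam k + b + ĉ k * lam k ^ 2))) *
        Real.exp (∑ k, (2 * t * φ k ^ 2 / lam k - stepGain (lam k) t b (ĉ k) * (φ k / lam k) ^ 2 - ĉ k * φ k ^ 2)) := by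
  rw [integral_stepModes_pi_of_nonneg hlam ht hb hĉ hφ, Real.exp_sum, ← Finset.prod_mul_distrib]
  refine Finset.prod_congr rfl fun k _ => ?_
  rw [mul_assoc, mul_assoc, ← Real.exp_add, ← Real.exp_add]
  congr 2
  ring

/-- The integrand family is integrable on `κ → ℝ` (each factor is a positive integrable Gaussian-type function; needed by consumers that split
the domain). It is the product of non-negative functions with a finite, explicitly computed integral, hence integrable. [cite: Wipf2021, §8.5.2 (8.64)–(8.67)] -/
theorem stepModes_integrand_nonneg {lam ĉ : κ → ℝ} {t b : ℝ} (φ w : κ → ℝ) :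
    0 ≤ ∏ k, Real.exp (-(b * w k ^ 2)) * Real.exp (-(t * (2 * φ k * w k + lam k * w k ^ 2))) *
        Real.exp (-(ĉ k * (φ k + lam k * w k) ^ 2)) :=
  Finset.prod_nonneg fun k _ => by positivity

end PiNonneg

end Summit.QuantumFields.YangMills.Theorems.FemtoTransferGap.TwoLattice.Harm

end
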